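import Summits.RiemannHypothesis.RiemannHypothesis.Theorems.TiltedLandingLaw421R3FLinkSeam
import Summits.RiemannHypothesis.RiemannHypothesis.Theorems.TiltedLandingLaw421R3FLinkGainSeam

/-! # FLinkGainBridge — the 90 ↔ 91 bridge (C4 W-09; director (CA867)(1): only after 90 and 91 both land, as a separate small image)
TWO tree imports: `…R3FLinkSeam` (C3 §3″ `FLinkBoxSeamSig' θ`, token 90) and `…R3FLinkGainSeam` (C4 `RemainderGainBoxSeamSig θ`, token 91).
ONE fact: the seam-bindered REMAINDER gain law implies the seam-bindered LATERAL gain law — #1238's `fLinkBoxSig'_of_remainderGainBox` with the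
seam hypothesis threaded (desk NOTE A l.8947).  Hence both seam sockets feed the one plumbed sink (90's `farFieldModulusLawBoxPl_of_fLinkBoxSeam`
after the bridge has the statement of 91's `farFieldModulusLawBoxPl_of_remainderGainBoxSeam` — not restated here), and the square of weakenings
from #1238's box law to §3″ commutes by name.  No converse is claimed (at an `M`-fold lowest the remainder form is stronger by the factor `M`
on the child side).  Sockets are HYPOTHESES typed OPEN.  Sorry-free; no type-class declarations, no custom syntax, no option changes.
Nothing here bears on the truth of RH; RH is NOT proved; ⟨33346⟩/⟨33347⟩ OPEN; checked ≠ landed ≠ proved. -/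

noncomputable section

namespace RhW08.FLinkGainBridge

open RhW08.BurgersRate RhW08.FLink RhW08.FLinkGain RhW08.FLinkSeam RhW08.FLinkGainSeam

/-- ★ (K) **THE 90 ↔ 91 BRIDGE**: the seam-bindered remainder gain law `RemainderGainBoxSeamSig θ` (#1238's `lineRem` form + seam) implies
C3's seam-bindered lateral gain law §3″ `FLinkBoxSeamSig' θ` (far-field form + seam): child leg `‖farFieldAt‖ ≤ ‖lineRem‖` (the `1/m`
identity), then the gain law with `hRB` threaded; `lineRem f j v R (linePt v w)` IS §3″'s right-hand field by definition. -/
theorem fLinkBoxSeamSig'_of_remainderGainBoxSeam {θ : ℝ} (hG : RemainderGainBoxSeamSig θ) : FLinkBoxSeamSig' θ := by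
  intro η f x₀ s hmax R Hs B hE j v w hfar hch hL hcol hh hRB hw hiso hw' hwim hd
  obtain ⟨-, hFv, hv0, -⟩ := hL.1
  have h1 : ‖farFieldAt f j v w‖ ≤ ‖lineRem f j v R w‖ := norm_farFieldAt_le_norm_lineRem hE hFv hv0 hiso hw hw'
  have h2 : ‖lineRem f j v R w‖ ≤ ‖lineRem f j v R (linePt v w)‖ + θ * η / s :=
    hG η f x₀ s hmax R Hs B hE j v w hfar hch hL hcol hh hRB hw hiso hw' hwim hd
  exact h1.trans h2

/-- (K) the square of weakenings commutes by name: #1238's box gain law reaches §3″ through §3′ (`fLinkBoxSig'_of_remainderGainBox`, then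
`fLinkBoxSeam_of_fLinkBox`) or through the seam-bindered remainder law (`remainderGainBoxSeam_of_remainderGainBox`, then the bridge). -/
theorem fLinkBoxSeamSig'_of_remainderGainBox {θ : ℝ} (hG : RemainderGainBoxSig θ) : FLinkBoxSeamSig' θ :=
  fLinkBoxSeamSig'_of_remainderGainBoxSeam (remainderGainBoxSeam_of_remainderGainBox hG)

end RhW08.FLinkGainBridge

end
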